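import Summits.CriticalPhenomena.PercolationContinuityZ3.Theorems.PercNearOneGluingNoHeavyQuantClusterLawTV
import Summits.CriticalPhenomena.PercolationContinuityZ3.Theorems.PercNearOneGluingNoHeavyQuantClusterLawDefect
import Summits.CriticalPhenomena.PercolationContinuityZ3.Theorems.PercNearOneGluingNoHeavyLowerTailCSHTheoremOne
import Literature.Probability.Percolation.ThetaContinuity
import Literature.Probability.Percolation.CriticalContinuityProofs
import HarnessLib

/-!
# QUANT lane (p4 gen 22): THE OSCILLATION THEOREM FOR THE CLUSTER LAW — `lim_{p'→p} ‖Law_{p'}(C) − Law_p(C)‖_TV = θ(p)`;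
# the cluster law is TV-continuous exactly where `θ = 0`, i.e. (p205010) exactly on `[0, p_c]`, every `d ≥ 2`

builds on p205010 (kernel theorem, internal audit signed; external expert review pending) — used ONLY in §3
(`CSH.percolationContinuity_allDimensions`: `θ(p_c) = 0`, every `d ≥ 2`).  §1–§2 are p205010-free.

Assembly of `…QuantClusterLawTV` (upper TV modulus `a_n(p) + 2dS_n(p)|p'−p|/(1−p)`) and `…QuantClusterLawDefect`
(TV defect `≥ θ(p)`), with `C = C(0)` the cluster of the origin of bond percolation on `ℤ^d`, "cluster event"
`B = {C ∈ 𝒜}` (`𝒜 ⊆ 𝒫(ℤ^d)` with `B` measurable), `‖·‖_TV = sup_B |P_p(B) − P_{p'}(B)|`: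

* §1 **`exists_delta_abs_sub_le_theta_add`** (UPPER HALF, every `d`, every `p`): `∀ ε > 0 ∃ δ > 0 ∀ p', |p' − p| < δ ⟹
  ∀ B: |P_p(B) − P_{p'}(B)| ≤ θ(p) + ε`;
* §2 **`exists_clusterEvent_abs_sub_ge_right/left`** (LOWER HALF, `d ≥ 2`): for every `p' > p`, and for all `p' < p`
  close to `p`, `∃ B: |P_p(B) − P_{p'}(B)| ≥ θ(p) − ε`; hence **`tvContinuousAt_iff_theta_eq_zero`**: the cluster law is
  continuous in total variation at `p` IFF `θ(p) = 0` (`d ≥ 2`, all `p ∈ [0,1]`) — the oscillation of `p ↦ Law_p(C)` at `p`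
  is exactly `θ(p)`;
* §3 (p205010) **`tvContinuousAt_criticalProbI`** — AT CRITICALITY THE CLUSTER LAW IS TV-CONTINUOUS, every `d ≥ 2`:
  `sup_B |P_{p_c}(B) − P_p(B)| → 0` as `p → p_c`, with the explicit one-sided modulus
  `inf_n [P_{p_c}(|C| ≥ n) + 2d·E_{p_c}[|C|∧n]·(p − p_c)/(1 − p_c)]` (`abs_sub_le_volume_modulus`, `a_n(p_c) ↓ θ(p_c) = 0`);
  **`tvContinuousAt_iff_le_criticalProbI`** — TV-continuous at `p` iff `p ≤ p_c`; **`tau_continuousAt_criticalProbI_uniform`**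
  — the two-point function `τ_p(0,x)` is continuous at `p_c` UNIFORMLY in `x` (and likewise every cluster functional).

Context: the tree's qualitative precursor `continuousAt_bondPercolation_real_of_clusterDetermined` (Hara's lemma) gives
continuity of `p ↦ P_p(E)` for ONE cluster-determined event at points where `C` is a.s. finite; here the statement is
uniform over all cluster events, quantitative, and two-sided (exact oscillation `θ(p)` where `C` is not a.s. finite).
HONEST: elementary on the two inputs; new as typed; no rate at `p_c` (the modulus is explicit modulo the critical profile
`a_n(p_c)`, `S_n(p_c)`, exactly as the lane's other (T2)-type statements).
-/

noncomputable section

namespace Summit.CriticalPhenomena.PercolationContinuityZ3.Theorems.ClusterLaw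

open MeasureTheory Filter Topology Literature.Probability.Percolation Literature.Probability.LatticeModels
open scoped ENNReal Classical

variable {d : ℕ}

/-- `cl⁻¹ 𝒜`: the cluster event `{ω | C(0)(ω) ∈ 𝒜}`. -/
local notation3 "cl⁻¹" 𝒜:arg => (fun ω : BondConfig (Site d) => openCluster ω (0 : Site d)) ⁻¹' 𝒜

/-- `P[p] B`: the `P_p`-probability of the event `B` on `ℤ^d`. -/
local notation3 "P[" p "]" => fun B : Set (BondConfig (Site d)) => (bondPercolation (zdGraph d) p).real B

/-- `aa p k = P_p(|C(0)| ≥ k)`. -/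
local notation3 "aa" => fun (p : unitInterval) (k : ℕ) =>
  (bondPercolation (zdGraph d) p).real (clusterSizeGe (0 : Site d) k)

/-! ### §1 The upper half: `limsup_{p'→p} sup_B |P_p(B) − P_{p'}(B)| ≤ θ(p)` -/

/-- `a_n` is non-decreasing in the parameter (`{|C| ≥ n}` is increasing; cf. `isUpperSet_clusterSizeGe`). -/
theorem aa_mono {p q : unitInterval} (hpq : p ≤ q) (n : ℕ) : aa p n ≤ aa q n :=
  DCT16.real_mono_of_isUpperSet (zdGraph d)
    (fun _ _ hle hω => le_trans hω (Set.encard_le_encard (openCluster_mono hle (0 : Site d))))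
    (measurableSet_clusterSizeGe 0 n) hpq

/-- Probabilities differ by at most `1`. -/
theorem abs_real_sub_real_le_one (p p' : unitInterval) (B : Set (BondConfig (Site d))) :
    |P[p] B - P[p'] B| ≤ 1 := by
  have h1 : 0 ≤ P[p] B := measureReal_nonneg
  have h2 : P[p] B ≤ 1 := measureReal_le_one
  have h3 : 0 ≤ P[p'] B := measureReal_nonneg
  have h4 : P[p'] B ≤ 1 := measureReal_le_one
  rw [abs_sub_le_iff]; constructor <;> linarith

/-- **Two-sided linear modulus around `p < 1`**: for `|p' − p| ≤ (1−p)/2`... in fact for every `p'` and every `n`,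
`|P_p(B) − P_{p'}(B)| ≤ a_n(p ⊔ p') + 2dn|p' − p|/(1 − p ⊔ p')`; we record the convenient form with the constants at `p`
for `p' ≤ p` and at `p` for `p' ≥ p`: `|P_p(B) − P_{p'}(B)| ≤ a_n(p ⊔ p') + 2dn|p'−p|/(1 − (p ⊔ p'))`. Here the case `p' ≤ p`. -/
theorem abs_sub_le_linear_modulus_left (p p' : unitInterval) (hpp : p' ≤ p) (hp1 : (p : ℝ) < 1)
    {𝒜 : Set (Set (Site d))} (h𝒜 : MeasurableSet (cl⁻¹ 𝒜)) (n : ℕ) :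
    |P[p] (cl⁻¹ 𝒜) - P[p'] (cl⁻¹ 𝒜)| ≤ aa p n + 2 * d * n * (((p : ℝ) - p') / (1 - p)) := by
  have hp'1 : (p' : ℝ) < 1 := lt_of_le_of_lt (show (p' : ℝ) ≤ p from hpp) hp1
  have h := abs_sub_le_linear_modulus p' p hpp hp'1 h𝒜 n
  rw [abs_sub_comm] at h
  refine h.trans ?_
  have hc : ((p : ℝ) - p') / (1 - p') ≤ ((p : ℝ) - p') / (1 - p) :=
    div_le_div_of_nonneg_left (sub_nonneg.2 hpp) (by linarith) (by linarith [show (p' : ℝ) ≤ p from hpp])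
  have := aa_mono (d := d) hpp n
  gcongr

/-- **UPPER HALF OF THE OSCILLATION THEOREM** (every `d`, every `p ∈ [0,1]`): for every `ε > 0` there is `δ > 0` such
that for all `p'` with `|p' − p| < δ` and ALL cluster events `B = {C ∈ 𝒜}`: `|P_p(B) − P_{p'}(B)| ≤ θ(p) + ε`
(`a_n(p) ↓ θ(p)` and the linear modulus; at `p = 1`, `d ≥ 1`, trivially since `θ(1) = 1`). -/
theorem exists_delta_abs_sub_le_theta_add (hd : 1 ≤ d) (p : unitInterval) {ε : ℝ} (hε : 0 < ε) :
    ∃ δ > 0, ∀ p' : unitInterval, |(p' : ℝ) - p| < δ → ∀ 𝒜 : Set (Set (Site d)), MeasurableSet (cl⁻¹ 𝒜) →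
      |P[p] (cl⁻¹ 𝒜) - P[p'] (cl⁻¹ 𝒜)| ≤ theta (zdGraph d) 0 p + ε := by
  rcases eq_or_lt_of_le (show (p : ℝ) ≤ 1 from p.2.2) with hp1 | hp1
  · -- `p = 1`: `θ(1) = 1`
    have hp : p = 1 := Subtype.ext hp1
    refine ⟨1, one_pos, fun p' _ 𝒜 _ => ?_⟩
    rw [hp, DCT16.theta_one hd]
    linarith [abs_real_sub_real_le_one (d := d) 1 p' (cl⁻¹ 𝒜)]
  · -- `p < 1`: choose `n` with `a_n(p) ≤ θ(p) + ε/2`, then `δ`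
    obtain ⟨n, hn⟩ : ∃ n : ℕ, aa p n < theta (zdGraph d) 0 p + ε / 2 :=
      ((tendsto_real_clusterSizeGe (zdGraph d) (0 : Site d) p).eventually
        (eventually_lt_nhds (by linarith))).exists
    set K : ℝ := 2 * d * n / (1 - p) with hK
    have hK0 : 0 ≤ K := by rw [hK]; exact div_nonneg (by positivity) (by linarith)
    refine ⟨ε / (2 * (K + 1)), by positivity, fun p' hp' 𝒜 h𝒜 => ?_⟩
    have hbound : ∀ t : ℝ, 0 ≤ t → t < ε / (2 * (K + 1)) → 2 * d * n * (t / (1 - p)) ≤ ε / 2 := by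
      intro t ht0 ht
      calc 2 * d * n * (t / (1 - p)) = K * t := by rw [hK]; ring
        _ ≤ (K + 1) * (ε / (2 * (K + 1))) := by
            refine mul_le_mul (by linarith) ht.le ht0 (by linarith)
        _ = ε / 2 := by field_simp
    rcases le_total p p' with hle | hle
    · have habs : |(p' : ℝ) - p| = p' - p := abs_of_nonneg (sub_nonneg.2 hle)
      have h := abs_sub_le_linear_modulus p p' hle hp1 h𝒜 n
      have h2 := hbound ((p' : ℝ) - p) (sub_nonneg.2 hle) (habs ▸ hp')
      linarith
    · have habs : |(p' : ℝ) - p| = p - p' := by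
        rw [abs_sub_comm]; exact abs_of_nonneg (sub_nonneg.2 hle)
      have h := abs_sub_le_linear_modulus_left p p' hle hp1 h𝒜 n
      have h2 := hbound ((p : ℝ) - p') (sub_nonneg.2 hle) (habs ▸ hp')
      linarith

/-! ### §2 The lower half and the continuity criterion -/

/-- **LOWER HALF, from the right** (`d ≥ 2`): for EVERY `p' > p` and `ε > 0` some cluster event has
`|P_p(B) − P_{p'}(B)| ≥ θ(p) − ε`. -/
theorem exists_clusterEvent_abs_sub_ge_right (hd : 2 ≤ d) (p p' : unitInterval) (hpp : p < p') {ε : ℝ} (hε : 0 < ε) :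
    ∃ 𝒜 : Set (Set (Site d)), MeasurableSet (cl⁻¹ 𝒜) ∧ theta (zdGraph d) 0 p - ε ≤ |P[p] (cl⁻¹ 𝒜) - P[p'] (cl⁻¹ 𝒜)| := by
  obtain ⟨𝒜, h𝒜, h⟩ := exists_clusterEvent_sub_ge hd p p' hpp hε
  exact ⟨𝒜, h𝒜, h.trans (le_abs_self _)⟩

/-- **LOWER HALF, from the left** (`d ≥ 2`): for every `ε > 0` there is `δ > 0` such that for every `p' < p` with
`p − p' < δ` some cluster event has `|P_p(B) − P_{p'}(B)| ≥ θ(p) − ε` (below `p_c` and at `p_c` the event `{|C| = ∞}`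
already gives `θ(p)`; above `p_c`, `θ` is left-continuous (van den Berg–Keane) and the defect at `(p', p)` is `≥ θ(p')`). -/
theorem exists_clusterEvent_abs_sub_ge_left (hd : 2 ≤ d) (p : unitInterval) {ε : ℝ} (hε : 0 < ε) :
    ∃ δ > 0, ∀ p' : unitInterval, p' < p → (p : ℝ) - p' < δ →
      ∃ 𝒜 : Set (Set (Site d)), MeasurableSet (cl⁻¹ 𝒜) ∧
        theta (zdGraph d) 0 p - ε ≤ |P[p] (cl⁻¹ 𝒜) - P[p'] (cl⁻¹ 𝒜)| := by
  by_cases hpc : criticalProb (zdGraph d) 0 < (p : ℝ)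
  · -- above `p_c`: left-continuity of `θ`
    have hcont := theta_continuousWithinAt_Iic_of_criticalProb_lt (d := d) p hpc
    rw [Metric.continuousWithinAt_iff] at hcont
    obtain ⟨δ, hδ, hball⟩ := hcont (ε / 2) (by linarith)
    refine ⟨δ, hδ, fun p' hlt hdist => ?_⟩
    have hθ : dist (theta (zdGraph d) 0 p') (theta (zdGraph d) 0 p) < ε / 2 :=
      hball hlt.le (by rw [Subtype.dist_eq, Real.dist_eq, abs_sub_comm, abs_of_nonneg (by linarith [show (p':ℝ) ≤ p from hlt.le])]; exact hdist)
    rw [Real.dist_eq, abs_sub_lt_iff] at hθ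
    obtain ⟨𝒜, h𝒜, h⟩ := exists_clusterEvent_sub_ge hd p' p hlt (show (0 : ℝ) < ε / 2 by linarith)
    refine ⟨𝒜, h𝒜, ?_⟩
    rw [abs_sub_comm]
    linarith [le_abs_self (P[p'] (cl⁻¹ 𝒜) - P[p] (cl⁻¹ 𝒜))]
  · -- at or below `p_c`: every `p' < p` has `θ(p') = 0`; witness `{|C| = ∞}`
    push Not at hpc
    refine ⟨1, one_pos, fun p' hlt _ => ⟨{S | S.Infinite}, measurableSet_percolatesAt_holds (0 : Site d), ?_⟩⟩
    have hθ' : theta (zdGraph d) 0 p' = 0 :=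
      theta_eq_zero_of_lt_criticalProb_holds (zdGraph d) 0 p' (lt_of_lt_of_le (show (p' : ℝ) < p from hlt) hpc)
    have e1 : P[p] (cl⁻¹ {S | S.Infinite}) = theta (zdGraph d) 0 p := rfl
    have e2 : P[p'] (cl⁻¹ {S | S.Infinite}) = theta (zdGraph d) 0 p' := rfl
    rw [e1, e2, hθ', sub_zero]
    linarith [le_abs_self (theta (zdGraph d) 0 p)]

/-- **THE CLUSTER LAW IS TV-CONTINUOUS AT `p` IFF `θ(p) = 0`** (`d ≥ 2`, every `p ∈ [0,1]`): the oscillation of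
`p ↦ Law_p(C(0))` in total variation at `p` is exactly `θ(p)`. -/
theorem tvContinuousAt_iff_theta_eq_zero (hd : 2 ≤ d) (p : unitInterval) :
    (∀ ε > 0, ∃ δ > 0, ∀ p' : unitInterval, |(p' : ℝ) - p| < δ → ∀ 𝒜 : Set (Set (Site d)), MeasurableSet (cl⁻¹ 𝒜) →
      |P[p] (cl⁻¹ 𝒜) - P[p'] (cl⁻¹ 𝒜)| ≤ ε) ↔ theta (zdGraph d) 0 p = 0 := by
  constructor
  · intro h
    by_contra hne
    have hθ0 : 0 ≤ theta (zdGraph d) 0 p := by unfold theta; exact measureReal_nonneg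
    have hpos : 0 < theta (zdGraph d) 0 p := lt_of_le_of_ne hθ0 (Ne.symm hne)
    set θ := theta (zdGraph d) 0 p with hθ
    obtain ⟨δ, hδ, hall⟩ := h (θ / 4) (by linarith)
    rcases eq_or_lt_of_le (show (p : ℝ) ≤ 1 from p.2.2) with hp1 | hp1
    · -- `p = 1`: use a point `p' < 1` on the left
      obtain ⟨δ', hδ', hleft⟩ := exists_clusterEvent_abs_sub_ge_left hd p (show (0 : ℝ) < θ / 4 by linarith)
      set t : ℝ := 1 - min (min δ δ') 1 / 2 with ht
      have ht0 : 0 ≤ t := by rw [ht]; linarith [min_le_right (min δ δ') 1]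
      have ht1 : t ≤ 1 := by rw [ht]; linarith [lt_min (lt_min hδ hδ') one_pos]
      set p' : unitInterval := ⟨t, ht0, ht1⟩ with hp'
      have hlt : p' < p := by
        show t < (p : ℝ); rw [hp1, ht]; linarith [lt_min (lt_min hδ hδ') one_pos]
      have hd1 : (p : ℝ) - p' < δ' := by
        show (p : ℝ) - t < δ'; rw [hp1, ht]
        linarith [min_le_right δ δ', min_le_left (min δ δ') 1]
      have hd2 : |(p' : ℝ) - p| < δ := by
        rw [abs_sub_comm, abs_of_nonneg (by linarith [show (p' : ℝ) ≤ p from hlt.le])]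
        show (p : ℝ) - t < δ; rw [hp1, ht]
        linarith [min_le_left δ δ', min_le_left (min δ δ') 1]
      obtain ⟨𝒜, h𝒜, hge⟩ := hleft p' hlt hd1
      have hle := hall p' hd2 𝒜 h𝒜
      linarith
    · -- `p < 1`: use a point `p' > p` on the right
      set t : ℝ := min ((p : ℝ) + δ / 2) 1 with ht
      have ht0 : 0 ≤ t := by rw [ht]; exact le_min (by linarith [p.2.1]) zero_le_one
      have ht1 : t ≤ 1 := min_le_right _ _
      set p' : unitInterval := ⟨t, ht0, ht1⟩ with hp'
      have hlt : p < p' := by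
        show (p : ℝ) < t; rw [ht]; exact lt_min (by linarith) hp1
      have hd2 : |(p' : ℝ) - p| < δ := by
        rw [abs_of_nonneg (by linarith [show (p : ℝ) ≤ p' from hlt.le])]
        show t - (p : ℝ) < δ; rw [ht]; linarith [min_le_left ((p : ℝ) + δ / 2) 1]
      obtain ⟨𝒜, h𝒜, hge⟩ := exists_clusterEvent_abs_sub_ge_right hd p p' hlt (show (0 : ℝ) < θ / 4 by linarith)
      have hle := hall p' hd2 𝒜 h𝒜
      linarith
  · intro hθ ε hε
    obtain ⟨δ, hδ, h⟩ := exists_delta_abs_sub_le_theta_add (d := d) (by omega) p hε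
    exact ⟨δ, hδ, fun p' hp' 𝒜 h𝒜 => by simpa [hθ] using h p' hp' 𝒜 h𝒜⟩

/-! ### §3 The p205010 reading: at criticality the cluster law is TV-continuous, in every `d ≥ 2` -/

/-- **AT CRITICALITY THE LAW OF THE CLUSTER IS CONTINUOUS IN TOTAL VARIATION** (every `d ≥ 2`; uses p205010's
`θ(p_c) = 0`): for every `ε > 0` there is `δ > 0` with `sup_B |P_{p_c}(B) − P_p(B)| ≤ ε` whenever `|p − p_c| < δ`, the sup
over all cluster events `B = {C(0) ∈ 𝒜}`.  The one-sided modulus is explicit modulo the critical profile: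
`≤ inf_n [P_{p_c}(|C| ≥ n) + 2d·E_{p_c}[|C|∧n]·(p − p_c)/(1 − p_c)]` for `p ≥ p_c` (`abs_sub_le_volume_modulus`). -/
theorem tvContinuousAt_criticalProbI (hd : 2 ≤ d) {ε : ℝ} (hε : 0 < ε) :
    ∃ δ > 0, ∀ p' : unitInterval, |(p' : ℝ) - criticalProbI d| < δ → ∀ 𝒜 : Set (Set (Site d)), MeasurableSet (cl⁻¹ 𝒜) →
      |P[criticalProbI d] (cl⁻¹ 𝒜) - P[p'] (cl⁻¹ 𝒜)| ≤ ε :=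
  (tvContinuousAt_iff_theta_eq_zero hd (criticalProbI d)).2 (CSH.percolationContinuity_allDimensions d hd) ε hε

/-- **TV-CONTINUOUS EXACTLY ON `[0, p_c]`** (every `d ≥ 2`; p205010 at `p = p_c`): the cluster law is continuous in total
variation at `p` iff `p ≤ p_c`. -/
theorem tvContinuousAt_iff_le_criticalProbI (hd : 2 ≤ d) (p : unitInterval) :
    (∀ ε > 0, ∃ δ > 0, ∀ p' : unitInterval, |(p' : ℝ) - p| < δ → ∀ 𝒜 : Set (Set (Site d)), MeasurableSet (cl⁻¹ 𝒜) →
      |P[p] (cl⁻¹ 𝒜) - P[p'] (cl⁻¹ 𝒜)| ≤ ε) ↔ p ≤ criticalProbI d := by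
  rw [tvContinuousAt_iff_theta_eq_zero hd p]
  constructor
  · intro hθ
    by_contra hlt
    push Not at hlt
    have hpos := theta_pos_of_criticalProb_lt_holds (zdGraph d) (0 : Site d) p
      (by rw [← coe_criticalProbI]; exact hlt)
    linarith
  · intro hle
    rcases hle.eq_or_lt with h | h
    · rw [h]; exact CSH.percolationContinuity_allDimensions d hd
    · exact theta_eq_zero_of_lt_criticalProb_holds (zdGraph d) 0 p (by rw [← coe_criticalProbI]; exact h)

/-- **THE TWO-POINT FUNCTION IS CONTINUOUS AT `p_c` UNIFORMLY IN THE TARGET** (every `d ≥ 2`; p205010): for every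
`ε > 0` there is `δ > 0` with `|τ_{p_c}(0,x) − τ_p(0,x)| ≤ ε` for ALL `x ∈ ℤ^d` whenever `|p − p_c| < δ`
(`{0 ↔ x} = {x ∈ C(0)}` is a cluster event).  The same holds verbatim for `P_p(C(0) ∩ A ≠ ∅)` for any `A ⊆ ℤ^d`, for
`P_p(|C(0)| ≥ n)` uniformly in `n`, etc. -/
theorem tau_continuousAt_criticalProbI_uniform (hd : 2 ≤ d) {ε : ℝ} (hε : 0 < ε) :
    ∃ δ > 0, ∀ p' : unitInterval, |(p' : ℝ) - criticalProbI d| < δ → ∀ x : Site d,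
      |(bondPercolation (zdGraph d) (criticalProbI d)).real (openConn (0 : Site d) x) -
        (bondPercolation (zdGraph d) p').real (openConn (0 : Site d) x)| ≤ ε := by
  obtain ⟨δ, hδ, h⟩ := tvContinuousAt_criticalProbI hd hε
  refine ⟨δ, hδ, fun p' hp' x => ?_⟩
  have hB : (openConn (0 : Site d) x : Set (BondConfig (Site d))) = cl⁻¹ {S | x ∈ S} := rfl
  rw [hB]
  exact h p' hp' {S | x ∈ S} (measurableSet_openConn_holds (0 : Site d) x)

end Summit.CriticalPhenomena.PercolationContinuityZ3.Theorems.ClusterLaw
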